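import Summits.BirchSwinnertonDyer.BirchSwinnertonDyer.Theorems.ManinLocalTwoThreeThreeShiftDescentEngine
import HarnessLib
import HarnessLib.Audit.Tags

/-!
# THEOREM III′ (E-es-99 `ThreeShiftAntiInvariantDescent`) HOLDS, THEOREM III at `27 ∣ M`, and the nine-shift equaliser law
# E-es-94♯ from three single-depth base laws (route `ManinLocalTwoThree`, cell bsd-f2-manin; crux C3 `ManinPrimeToThreeAtNine`
# stmt-BirchSwinnertonDyer-22968; prover seat p3 gen 10, es ask P-es-2)

With the descent engine of the sibling files (`…ThreeShiftGlue`, `…ThreeShiftDescentEngine`: `ThreeShiftDescent.descent` — an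
additive `ε`-invariant `φ : Γ₀(9m) → 𝔽₃` with `φ(P_{2/3}) = φ(P_{1/3})` is a restriction from `Γ₀(3m)`), this file supplies the
VANISHING `φ(P_{1/3}) = φ(P_{2/3}) = 0` whenever `27 ∣ 3m` (`apply_P13_eq_zero_and`: `φ(P_{a/3}) = ε φ(g_a)` by the `ε`-invariance
at `(1 − 3am, a²m/3; −9m, 1 + 3am)`, and `g_a = (P′_a)³` is the cube of the parabolic `P′_a = I + m′(−9a, a²; −81, 9a)` of
`Γ₀(9m)`, `m = 9m′` — `parabolic_cube`), and concludes:
* **`threeShiftAntiInvariantDescent_holds : ThreeShiftAntiInvariantDescent`** — es's THEOREM III′ = E-es-99 BY NAME (`ε = −1`),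
  WITHOUT Bass–Serre theory and WITHOUT the Heisenberg lift of MEMO-es §37.8 (iii);
* **`threeShiftTowerDescent_of_twentySeven_dvd`** — THEOREM III (E-es-98 `ThreeShiftTowerDescent`) at every `27 ∣ M` (`ε = 1`); the
  single step `9 ∥ M` of E-es-98 (where `P′_a ∉ Γ₀(3M)` and es's Heisenberg pair is needed) is NOT proved here;
* the typed row **E-p3-B27 `ThreeShiftBaseTwentySeven`** (`K₃^grp(27N₀) = D^grp(27N₀)` for `3 ∤ N₀`; @[conjecture], NOTHING
  ASSERTED; finite `𝔽₃`-linear algebra per `N₀`, es ENGINE 5 Table A certifies `N₀ ≤ 8`) and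
  **`nineShiftInvariantIsDiamond_of_bases : ThreeShiftBaseNine → ThreeShiftBaseTwentySeven → AntiInvariantBaseTwentySeven →
  NineShiftInvariantIsDiamond`** — E-es-94♯ at EVERY `9 ∣ N` from three single-depth base laws and NO descent conjecture (the
  anti-invariant tower runs on the proved III′, the invariant tower above depth 27 on the proved III, via the glue of
  `…NineShiftTowerReduction.lean`).
So of es's TowerReduction inputs (E-es-98/99/100a/100b) the descents are now theorems except the one `9 ∥ M` step of E-es-98, which
is traded for the depth-27 base E-p3-B27.  BSD is not proved by this; Manin's conjecture is not proved by this; E-es-94♯ and C3 stay OPEN.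
Reference: cell memo HOME/MEMO-es.md §37.8 (iii)–(vi) [cite: DarmonDiamondTaylor1995, Lemma 4.28 (p. 135)].
-/

set_option autoImplicit false
set_option linter.dupNamespace false

open scoped MatrixGroups

open CongruenceSubgroup Matrix.SpecialLinearGroup
  Summit.BirchSwinnertonDyer.Rank1Residual.ManinAdditive.NineShiftEqualiser

namespace Summit.BirchSwinnertonDyer.BirchSwinnertonDyer.Theorems.ManinLocalTwoThree

namespace ThreeShiftDescent

/-! ### §6. At `27 ∣ 3m`: `φ(P_{1/3}) = φ(P_{2/3}) = 0`, hence THEOREM III′ (E-es-99) and THEOREM III at `27 ∣ M` -/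

section TwentySeven

variable {m' : ℕ}

/-- An additive `𝔽₃`-valued function kills cubes. [folklore] -/
theorem isAddChar_map_cube {N : ℕ} {φ : Gamma0 N → ZMod 3} (hφ : IsAddChar φ) (x : Gamma0 N) :
    φ (x * x * x) = 0 := by
  rw [hφ, hφ]
  have : φ x + φ x + φ x = 3 * φ x := by ring
  rw [this, show (3 : ZMod 3) = 0 from rfl, zero_mul]

/-- The cube of the parabolic `P′_a = I + m′(−9a, a²; −81, 9a)` of `Γ₀(81m′)` is `g_a = I + 3m′(−9a, a²; −81, 9a)`
(`X_a² = 0`). [folklore] -/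
theorem parabolic_cube (a : ℤ) (h₁ : (1 - 9 * a * m') * (1 + 9 * a * m') - (a * a * m') * (-(81 * m')) = 1)
    (h₃ : (1 - 27 * a * m') * (1 + 27 * a * m') - (3 * (a * a * m')) * (-(243 * m')) = 1)
    (hc₁ : ((3 * (3 * (9 * m')) : ℕ) : ℤ) ∣ -(81 * m')) (hc₃ : ((3 * (3 * (9 * m')) : ℕ) : ℤ) ∣ -(243 * m')) :
    (g0Of (1 - 9 * a * m') (a * a * m') (-(81 * m')) (1 + 9 * a * m') h₁ hc₁ : Gamma0 (3 * (3 * (9 * m')))) *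
        g0Of (1 - 9 * a * m') (a * a * m') (-(81 * m')) (1 + 9 * a * m') h₁ hc₁ *
        g0Of (1 - 9 * a * m') (a * a * m') (-(81 * m')) (1 + 9 * a * m') h₁ hc₁ =
      g0Of (1 - 27 * a * m') (3 * (a * a * m')) (-(243 * m')) (1 + 27 * a * m') h₃ hc₃ := by
  rw [g0Of_mul _ _ _ _ _ _ _ _ h₁ hc₁ h₁ hc₁ (det_mul_entries h₁ h₁)
      (dvd_add (Dvd.dvd.mul_right hc₁ _) (Dvd.dvd.mul_left hc₁ _)),
    g0Of_mul _ _ _ _ _ _ _ _ _ _ h₁ hc₁ (det_mul_entries (det_mul_entries h₁ h₁) h₁)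
      (dvd_add (Dvd.dvd.mul_right (dvd_add (Dvd.dvd.mul_right hc₁ _) (Dvd.dvd.mul_left hc₁ _)) _)
        (Dvd.dvd.mul_left hc₁ _))]
  exact g0Of_congr (by ring) (by ring) (by ring) (by ring) _ _ _ _

/-- **At `27 ∣ 3m` (`m = 9m′`) an additive `ε`-invariant `φ` kills `P_{1/3}` and `P_{2/3}`**: `φ(P_{a/3}) = ε φ(g_a)` by the
`ε`-invariance at `(1 − 3am, a²m/3; −9m, 1 + 3am)`, and `g_a = (P′_a)³` is a cube in `Γ₀(9m)`. [folklore] -/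
theorem apply_P13_eq_zero_and (φ : Gamma0 (3 * (3 * (9 * m'))) → ZMod 3) (ε : ZMod 3) (hadd : IsAddChar φ)
    (hinv : ∀ (a b c d : ℤ) (h : a * d - b * (3 * c) = 1) (hc : ((3 * (3 * (9 * m')) : ℕ) : ℤ) ∣ c),
      φ (g0Of a (3 * b) c d (by linear_combination h) hc) = ε * φ (g0Of a b (3 * c) d h (Dvd.dvd.mul_left hc 3))) :
    φ (P13 (9 * m')) = 0 ∧ φ (P23 (9 * m')) = 0 := by
  have hc9 : ((3 * (3 * (9 * m')) : ℕ) : ℤ) ∣ -(81 * m') := ⟨-1, by push_cast; ring⟩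
  have hc27 : ((3 * (3 * (9 * m')) : ℕ) : ℤ) ∣ -(243 * m') := ⟨-3, by push_cast; ring⟩
  constructor
  · have key := hinv (1 - 27 * m') (3 * m') (-(81 * m')) (1 + 27 * m') (by ring) hc9
    have e₁ : P13 (9 * m') = g0Of (1 - 27 * m') (3 * (3 * m')) (-(81 * m')) (1 + 27 * m') (by ring) hc9 := by
      unfold P13; exact g0Of_congr (by push_cast; ring) (by push_cast; ring) (by push_cast; ring) (by push_cast; ring) _ _ _ _
    have e₂ : g0Of (M := 3 * (3 * (9 * m'))) (1 - 27 * m') (3 * m') (3 * -(81 * m')) (1 + 27 * m') (by ring)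
          (Dvd.dvd.mul_left hc9 3) =
        g0Of (1 - 27 * 1 * m') (3 * (1 * 1 * m')) (-(243 * m')) (1 + 27 * 1 * m') (by ring) hc27 :=
      g0Of_congr (by ring) (by ring) (by ring) (by ring) _ _ _ _
    rw [e₁, key, e₂, ← parabolic_cube 1 (by ring) (by ring) hc9 hc27, isAddChar_map_cube hadd, mul_zero]
  · have key := hinv (1 - 54 * m') (12 * m') (-(81 * m')) (1 + 54 * m') (by ring) hc9
    have e₁ : P23 (9 * m') = g0Of (1 - 54 * m') (3 * (12 * m')) (-(81 * m')) (1 + 54 * m') (by ring) hc9 := by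
      unfold P23; exact g0Of_congr (by push_cast; ring) (by push_cast; ring) (by push_cast; ring) (by push_cast; ring) _ _ _ _
    have e₂ : g0Of (M := 3 * (3 * (9 * m'))) (1 - 54 * m') (12 * m') (3 * -(81 * m')) (1 + 54 * m') (by ring)
          (Dvd.dvd.mul_left hc9 3) =
        g0Of (1 - 27 * 2 * m') (3 * (2 * 2 * m')) (-(243 * m')) (1 + 27 * 2 * m') (by ring) hc27 :=
      g0Of_congr (by ring) (by ring) (by ring) (by ring) _ _ _ _
    rw [e₁, key, e₂, ← parabolic_cube 2 (by ring) (by ring) hc9 hc27, isAddChar_map_cube hadd, mul_zero]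

/-- **Descent at `27 ∣ 3m` for both signs** (engine + vanishing). [folklore] -/
theorem descent_twentySeven (φ : Gamma0 (3 * (3 * (9 * m'))) → ZMod 3) (ε : ZMod 3) (hadd : IsAddChar φ)
    (hinv : ∀ (a b c d : ℤ) (h : a * d - b * (3 * c) = 1) (hc : ((3 * (3 * (9 * m')) : ℕ) : ℤ) ∣ c),
      φ (g0Of a (3 * b) c d (by linear_combination h) hc) = ε * φ (g0Of a b (3 * c) d h (Dvd.dvd.mul_left hc 3))) :
    ∃ w : Gamma0 (3 * (9 * m')) → ZMod 3, IsAddChar w ∧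
      (∀ (a b c d : ℤ) (h : a * d - b * (3 * c) = 1) (hc : ((3 * (9 * m') : ℕ) : ℤ) ∣ c),
        w (g0Of a (3 * b) c d (by linear_combination h) hc) = ε * w (g0Of a b (3 * c) d h (Dvd.dvd.mul_left hc 3))) ∧
      RestrictsFrom φ w := by
  obtain ⟨h1, h2⟩ := apply_P13_eq_zero_and φ ε hadd hinv
  exact descent φ ε hadd hinv (by rw [h1, h2])

end TwentySeven

end ThreeShiftDescent

open ThreeShiftDescent in
/-- **THEOREM III′ = E-es-99 `ThreeShiftAntiInvariantDescent` HOLDS**: for `27 ∣ M`, every additive 3-shift-anti-invariant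
`ψ : Γ₀(3M) → 𝔽₃` is the restriction of an additive 3-shift-anti-invariant `w : Γ₀(M) → 𝔽₃`.  Elementary (no Bass–Serre):
`descent_twentySeven` with `ε = −1`. [folklore] -/
theorem threeShiftAntiInvariantDescent_holds : ThreeShiftAntiInvariantDescent := by
  intro M h27
  obtain ⟨m', rfl⟩ : ∃ m', M = 3 * (9 * m') := by
    obtain ⟨k, hk⟩ := h27; exact ⟨k, by rw [hk]; ring⟩
  intro ψ hadd hanti
  have hinv : ∀ (a b c d : ℤ) (h : a * d - b * (3 * c) = 1) (hc : ((3 * (3 * (9 * m')) : ℕ) : ℤ) ∣ c),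
      ψ (g0Of a (3 * b) c d (by linear_combination h) hc) = (-1) * ψ (g0Of a b (3 * c) d h (Dvd.dvd.mul_left hc 3)) :=
    fun a b c d h hc => by rw [hanti a b c d h hc, neg_one_mul]
  obtain ⟨w, hwadd, hwε, hres⟩ := descent_twentySeven ψ (-1) hadd hinv
  exact ⟨w, hwadd, fun a b c d h hc => by rw [hwε a b c d h hc, neg_one_mul], hres⟩

open ThreeShiftDescent in
/-- **THEOREM III at `27 ∣ M`**: for `27 ∣ M`, every additive 3-shift-invariant `φ : Γ₀(3M) → 𝔽₃` is the restriction of an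
additive 3-shift-invariant `w : Γ₀(M) → 𝔽₃` (es's E-es-98 `ThreeShiftTowerDescent` asks this for all `9 ∣ M`; the step `9 ∥ M` is
the one place where the Heisenberg pair of MEMO-es §37.8 (iii) is needed and is NOT proved here). [folklore] -/
theorem threeShiftTowerDescent_of_twentySeven_dvd (M : ℕ) (h27 : 27 ∣ M) (φ : Gamma0 (3 * M) → ZMod 3)
    (hadd : IsAddChar φ) (hinv3 : IsThreeShiftInvariant φ) :
    ∃ w : Gamma0 M → ZMod 3, IsAddChar w ∧ IsThreeShiftInvariant w ∧ RestrictsFrom φ w := by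
  obtain ⟨m', rfl⟩ : ∃ m', M = 3 * (9 * m') := by
    obtain ⟨k, hk⟩ := h27; exact ⟨k, by rw [hk]; ring⟩
  have hinv : ∀ (a b c d : ℤ) (h : a * d - b * (3 * c) = 1) (hc : ((3 * (3 * (9 * m')) : ℕ) : ℤ) ∣ c),
      φ (g0Of a (3 * b) c d (by linear_combination h) hc) = 1 * φ (g0Of a b (3 * c) d h (Dvd.dvd.mul_left hc 3)) :=
    fun a b c d h hc => by rw [hinv3 a b c d h hc, one_mul]
  obtain ⟨w, hwadd, hwε, hres⟩ := descent_twentySeven φ 1 hadd hinv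
  exact ⟨w, hwadd, fun a b c d h hc => by rw [hwε a b c d h hc, one_mul], hres⟩

/-! ### §7. The tower reduction with PROVED descents: E-es-94♯ from three single-depth base laws -/

/-- **E-p3-B27 (single 3-adic depth; NOTHING ASSERTED): `K₃^grp(27N₀) = D^grp(27N₀)` for `3 ∤ N₀`** — the base of the
3-shift tower at depth `27`, the analogue of es's E-es-100a `ThreeShiftBaseNine` one level up (finite `𝔽₃`-linear algebra per
`N₀`; es ENGINE 5 Table A certifies `dim K₃^grp(N) = r₃(N)` at all `N ≤ 240` without order-3 elliptic points, covering `27N₀`,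
`N₀ ≤ 8`).  With it the 3-adic tower needs NO descent conjecture above depth 27 (`nineShiftInvariantIsDiamond_of_bases`).
[cite: Ribet1984ICM, Thm. 4.3 (shape only — the depth-27 base law is the cell's row E-p3-B27, NOT in print)] -/
@[conjecture] def ThreeShiftBaseTwentySeven : Prop :=
  ∀ N₀ : ℕ, 0 < N₀ → ¬ 3 ∣ N₀ → ThreeShiftInvariantIsDiamondAt (27 * N₀)

/-- Invariant tower down to depth `27` with the PROVED descent `threeShiftTowerDescent_of_twentySeven_dvd`. [folklore] -/
theorem isDiamondChar_of_tower27 (hB : ThreeShiftBaseTwentySeven) {N₀ : ℕ} (hN₀ : 0 < N₀) (h3 : ¬ 3 ∣ N₀) :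
    ∀ (j L : ℕ), L = 3 ^ j * (27 * N₀) → ∀ φ : Gamma0 L → ZMod 3, IsAddChar φ → IsThreeShiftInvariant φ →
      IsDiamondChar φ := by
  intro j
  induction j with
  | zero =>
      intro L hL φ hadd hinv
      have hL' : L = 27 * N₀ := by rw [hL]; ring
      subst hL'
      exact hB N₀ hN₀ h3 φ hadd hinv
  | succ j ih =>
      intro L hL φ hadd hinv
      have hL' : L = 3 * (3 ^ j * (27 * N₀)) := by rw [hL]; ring
      subst hL'
      have h27 : 27 ∣ 3 ^ j * (27 * N₀) := ⟨3 ^ j * N₀, by ring⟩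
      obtain ⟨w, hwadd, hwinv, hres⟩ := threeShiftTowerDescent_of_twentySeven_dvd _ h27 φ hadd hinv
      exact isDiamondChar_of_restrictsFrom ⟨3, by ring⟩ hres (ih (3 ^ j * (27 * N₀)) rfl w hwadd hwinv)

/-- **E-es-94♯ ⟸ three single-depth base laws** (no descent conjecture): `ThreeShiftBaseNine` (E-es-100a, used only at the
levels `9N₀` themselves), `ThreeShiftBaseTwentySeven` (E-p3-B27) and `AntiInvariantBaseTwentySeven` (E-es-100b) imply
`NineShiftInvariantIsDiamond` at every level `9 ∣ N` — the anti-invariant descent is the PROVED THEOREM III′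
(`threeShiftAntiInvariantDescent_holds`) and the invariant descent above depth 27 is the PROVED `threeShiftTowerDescent_of_twentySeven_dvd`.
[cite: Ribet1984ICM, Thm. 4.3 (shape only)] -/
theorem nineShiftInvariantIsDiamond_of_bases (hB9 : ThreeShiftBaseNine) (hB27 : ThreeShiftBaseTwentySeven)
    (hB27m : AntiInvariantBaseTwentySeven) : NineShiftInvariantIsDiamond := by
  intro N h9N φ hadd h9
  by_cases hN0 : N = 0
  · subst hN0
    exact nineShiftInvariantIsDiamond_zero φ hadd h9
  obtain ⟨k, N₀, h3, hN⟩ := Nat.exists_eq_pow_mul_and_not_dvd hN0 3 (by norm_num)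
  have hN₀ : 0 < N₀ := by
    rcases Nat.eq_zero_or_pos N₀ with h | h
    · exact absurd (by rw [hN, h, mul_zero]) hN0
    · exact h
  have hk : 2 ≤ k := by
    by_contra hk
    have hk' : k = 0 ∨ k = 1 := by omega
    rcases hk' with rfl | rfl
    · apply h3
      have : 9 ∣ N₀ := by simpa [hN] using h9N
      exact (dvd_trans ⟨3, by norm_num⟩ this)
    · apply h3
      have h9' : 9 ∣ 3 * N₀ := by simpa [hN] using h9N
      obtain ⟨q, hq⟩ := h9'
      exact ⟨q, by omega⟩
  obtain ⟨j, rfl⟩ : ∃ j, k = j + 2 := ⟨k - 2, by omega⟩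
  -- the 3-shift defect vanishes (III′ proved + E-es-100b), so `φ` is 3-shift invariant
  have hL3 : 3 * N = 3 ^ j * (27 * N₀) := by rw [hN]; ring
  have hψ0 := eq_zero_of_antiInvariant_tower threeShiftAntiInvariantDescent_holds hB27m hN₀ h3 j (3 * N) hL3 _
    (isAddChar_shiftDefect hadd) (isThreeShiftAntiInvariant_shiftDefect h9)
  have h3inv : IsThreeShiftInvariant φ := isThreeShiftInvariant_of_shiftDefect_eq_zero hψ0
  -- depth 9 exactly: base E-es-100a; depth ≥ 27: descend to 27N₀ by the proved III and use E-p3-B27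
  rcases j with _ | j
  · have hL9 : N = 9 * N₀ := by rw [hN]; ring
    subst hL9
    exact hB9 N₀ hN₀ h3 φ hadd h3inv
  · have hL27 : N = 3 ^ j * (27 * N₀) := by rw [hN]; ring
    exact isDiamondChar_of_tower27 hB27 hN₀ h3 j N hL27 φ hadd h3inv

end Summit.BirchSwinnertonDyer.BirchSwinnertonDyer.Theorems.ManinLocalTwoThree
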